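/-
Copyright (c) 2026. All rights reserved.
Released under Apache 2.0 license as described in the file LICENSE.
Authors: abc-iut cell — seat abc-iut-w5-d053 (wave 5, gen 3; FACT-LIST block F, row F-1918 `TotallyRamifiedCriterion`
of plan/F-TRANCHES.tsv tranche 183: universal closure REFUTED + model witness).
-/
import Mathlib.Topology.Instances.ZMod
import Literature.AnabelianGeometry.AbsoluteAnabelian.AbsTopIGraphCuspidalNonVacuity
import HarnessLib

/-!
# FACT-LIST row F-1918 `TotallyRamifiedCriterion` ([IUTchI] Rmk 1.2.2 (i)): kernel status of the parametrised predicate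

S. Mochizuki, *Inter-universal Teichmüller theory I* [Mochizuki2012], Rmk 1.2.2 (i) p. 40, amending the proof of
[AbsAnab] Lemma 1.3.9 [MochizukiAbsAnab2004] p. 19: the cyclic covering `Zᵢ → Vᵢ` "is totally ramified … is easily
verified to be equivalent to the condition that the covering `Zᵢ → Vᵢ` admit a factorization `Zᵢ → Wᵢ → Vᵢ`, where
`Wᵢ → Vᵢ` is finite étale of degree `l`, and `r_{Wᵢ} < l · r_{Vᵢ}`".

abc-iut-L4-t4 typed the criterion as the PARAMETRISED predicate
`FundamentalExtension.TotallyRamifiedCriterion l c V J` (`AbsTopIChains.lean`) over abstract cusp-number data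
`c : CuspNumberData D` on a topological group `D`; plan/FACT-LIST.md lists it as F-1918 (kernel_closedness =
parametrised, status fact-open).  A parametrised predicate is not a theorem: this PROOF-ONLY file records its
kernel status in the two forms the FACT-LIST render reads (block F grammar, plan/F-TRANCHES.tsv header):

* `not_forall_totallyRamifiedCriterion` — the UNIVERSAL CLOSURE IS REFUTED: with the zero cusp-number function
  (the proper case, no cusps at any level) no pair `J ≤ V` satisfies the criterion (`r_W < l · r_V` would read
  `0 < 0`), by abc-iut-w5-d053's `not_totallyRamifiedCriterion_of_r_eq_zero` (p423819); closed instance at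
  `D := Multiplicative ℤ`, `l := 2`, `V = J = ⊤`.  Kind: SCHEMA-REFUTED (the row is a definition of a condition,
  to be ASSUMED of specific coverings, never a statement about all of them).
* `exists_totallyRamifiedCriterion` / `totallyRamifiedCriterion_top_bot_of_card` — the predicate is SATISFIABLE:
  in any group `D` of order `l ≥ 2` with a constant positive cusp-number function `r ≡ n`, the pair
  `J := 1 ≤ V := D` satisfies it with `W := 1` (`[D : 1] = l`, `n < l · n`); closed instance at
  `D := Multiplicative (ZMod 2)`, `l := 2`, `r ≡ 1` (a degree-`2` covering of a once-punctured curve totally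
  ramified at the cusp has `1 < 2 · 1` cusps — the numerology of a genuine example, on DEGENERATE group data).

HONEST FRAMING: bookkeeping about the cell's typed predicate; nothing of [IUTchI] / [AbsAnab] is asserted or
impugned (the print states a criterion, not a universal claim); nothing here bears on the disputed [IUTchIII]
Cor. 3.12.
-/

namespace Literature.AnabelianGeometry.AbsoluteAnabelian

namespace FundamentalExtension

universe u

/-- **F-1918, model witness (general form)**: in a group `D` of finite order `l ≥ 2`, for a CONSTANT positive
cusp-number function `r ≡ n`, the pair `J := ⊥ ≤ V := ⊤` satisfies the amended total-ramification criterion with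
intermediate subgroup `W := ⊥` (`[⊤ : ⊥] = #D = l` and `n < l · n`).
[cite: Mochizuki2012, IUTchI Rmk 1.2.2 (i) p.40] -/
theorem totallyRamifiedCriterion_top_bot_of_card {D : Type u} [Group D] [TopologicalSpace D] {l n : ℕ}
    (hl : 2 ≤ l) (hn : 0 < n) (hcard : Nat.card D = l) {c : CuspNumberData D} (hc : ∀ V, c.r V = n) :
    TotallyRamifiedCriterion l c ⊤ ⊥ := by
  rw [totallyRamifiedCriterion_iff_of_r_const hl hn hc]
  refine ⟨⊥, le_rfl, bot_le, ?_⟩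
  rw [Subgroup.relIndex_top_right, Subgroup.index_bot, hcard]

/-- **F-1918 is SATISFIABLE (closed instance)**: at `D := ℤ/2` (written multiplicatively, discrete topology),
`l := 2`, `r ≡ 1`, the criterion holds for `J := 1 ≤ V := D` — the numerology `r_W = 1 < 2 · 1 = l · r_V` of a
degree-`2` cyclic covering of a once-punctured curve totally ramified at its cusp, on degenerate group data.
[cite: Mochizuki2012, IUTchI Rmk 1.2.2 (i) p.40] -/
theorem exists_totallyRamifiedCriterion :
    ∃ (D : Type) (_ : Group D) (_ : TopologicalSpace D) (l : ℕ) (c : CuspNumberData D) (V J : Subgroup D),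
      TotallyRamifiedCriterion l c V J :=
  ⟨Multiplicative (ZMod 2), inferInstance, inferInstance, 2, ⟨fun _ => 1⟩, ⊤, ⊥,
    totallyRamifiedCriterion_top_bot_of_card (D := Multiplicative (ZMod 2)) (n := 1) le_rfl Nat.one_pos
      (Nat.card_zmod 2) fun _ => rfl⟩

/-- **F-1918, UNIVERSAL CLOSURE REFUTED** (SCHEMA-REFUTED): it is NOT the case that every pair `J ≤ V` in every
topological group with every cusp-number function satisfies the total-ramification criterion — with the zero
cusp-number function nothing does (`not_totallyRamifiedCriterion_of_r_eq_zero`); instance `D := ℤ`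
(multiplicative), `l := 2`, `V = J = ⊤`.  The row is a CONDITION to be assumed of specific coverings.
[cite: Mochizuki2012, IUTchI Rmk 1.2.2 (i) p.40] -/
theorem not_forall_totallyRamifiedCriterion :
    ¬ ∀ (D : Type) [Group D] [TopologicalSpace D] (l : ℕ) (c : CuspNumberData D) (V J : Subgroup D),
      TotallyRamifiedCriterion l c V J :=
  fun h => not_totallyRamifiedCriterion_of_r_eq_zero (D := Multiplicative ℤ) 2 (c := ⟨fun _ => 0⟩)
    (fun _ => rfl) ⊤ ⊤ (h (Multiplicative ℤ) 2 ⟨fun _ => 0⟩ ⊤ ⊤)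

/-- … and already in each fixed group: for every topological group `D` and every `l` there are cusp-number data and
subgroups violating the criterion (the zero function). [cite: Mochizuki2012, IUTchI Rmk 1.2.2 (i) p.40] -/
theorem exists_not_totallyRamifiedCriterion (D : Type u) [Group D] [TopologicalSpace D] (l : ℕ) :
    ∃ (c : CuspNumberData D) (V J : Subgroup D), ¬ TotallyRamifiedCriterion l c V J :=
  ⟨⟨fun _ => 0⟩, ⊤, ⊤, not_totallyRamifiedCriterion_of_r_eq_zero l (fun _ => rfl) ⊤ ⊤⟩

end FundamentalExtension

end Literature.AnabelianGeometry.AbsoluteAnabelian
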